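import Summits.QuantumFields.BalabanUV.T4Continuum.Spine.NE1p.DressedTransportAssembledModSliceWin
import Summits.QuantumFields.BalabanUV.T4Continuum.Spine.NE1p.DressedTransportAssembledModData

/-!
# T⁴ programme, spine estimate NE1′ (node O3b/H2) — END-F′-mod-swin OVER CANONICAL DATA: the moduli face of the assembled
# transport leaf under PER-STEP SLICE WINDOWS, and its ONE-SCHEDULE form, with NO bookkeeping functions displayed (swarm row S2
# «END-F′ plumbing» of `t4/formal/NE1p/LEAVES.md`, supplier item S2k «mod-swin ∘ canonical» of the same seat; the «canonical»
# factor of the terminal object «END-ALL over (mod ∘ canonical ∘ slice-win ∘ schedule-win)» of `t4/formal/NE1p/DAG.md` §3)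

Cell `pub-balaban`, sub-cell `t4`, BINDER-OWNERS row NE1′, NE1′ FORMALISATION SWARM `b2b-balaban-t4-ne1p-formalise-*`, leaf
prover 01 (unit `b2b-balaban-t4-ne1p-formalise-leaf-01`, gen 3); owner lineage t4-ne1p-p1 (skeleton `t4/skeletons/NE1p-t4-ne1p-p1.md`
v1.1 §6 seat S2); tree target `Summits/QuantumFields/BalabanUV/T4Continuum/Spine/NE1p/`; ADDITIVE — imports leaf-04's per-step
SLICE-window moduli face `Spine/NE1p/DressedTransportAssembledModSliceWin` (END-F′-mod-swin `transportLeaf_assembled_mod_swin` and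
its one-schedule form `transportLeaf_assembled_mod_swin_of_schedule`, row S1e part 5 — the cure of located finding F-ne1pleaf04-1 =
LF-2) and this seat's `Spine/NE1p/DressedTransportAssembledModData` (the canonical data `aszRec`/`s1Mod` + `rsOf`/`rsOf_dec`, row S2i)
ONLY; modifies nothing.

WHY.  END-F′-mod-swin (leaf-04, row S1e-5) is leaf-08's END-F′-mod-win with the cross-family margins `hN2cx`/`hpairx` and the
produced `hP` guarded by the PER-STEP slice window `wk b k′ (k+1)` instead of the uniform `w` — the face on which a bond-ball
schedule's birth window is CUTOFF-FREE for the ASSEMBLED leaf (`WindowScheduleModWin.geometric`: `ρ∞ + ((1+2q)σ₀+ϱ₀)/(1−q)`).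
It still carries the three FREE bookkeeping functions of every assembled face — the closed-form step budget `s1` (`hs1`), the
slice sizes `Asz` (`hAsz_birth`/`hAsz_step`) and, in the schedule-free form, the slice radii `rs` (`hrs_birth`/`hrs_step`, ordered
by `hrs_dec`) — constrained by equalities «the instantiation defines».  `DressedTransportAssembledModData` determined them once by
plain recursions on the scale; this file is the two-line substitution on the slice-window faces:
* **`transportLeaf_assembled_mod_swin_canonical`** [bookkeeping] — `transportLeaf_assembled_mod_swin` with `rs := rsOf r ϱ`,
  `Asz := aszRec T.gen s (s1Mod T.gen r α c Sg δf)`, `s1 := s1Mod T.gen r α c Sg δf`: the SIX bookkeeping binders `hs1`/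
  `hAsz_birth`/`hAsz_step`/`hrs_birth`/`hrs_step`/`hrs_dec` are GONE (and `s1`/`rs`/`Asz` leave the signature), replaced by the
  schedule inequalities `hϱ_birth : ϱ f k″ k″ < r`, `hϱ_succ : ϱ f k″ (k+1) < ϱ f k″ k`; `hmargin`'s last clause reads
  `ϱ₁ b k ≤ rsOf r ϱ p.1 p.2 k`; every other binder is END-F′-mod-swin's VERBATIM (per-step slice windows `wk`, `hwkx`,
  `hN2cx`/`hpairx` guarded `latN pd ≤ wk b k′ (k+1)`, NO uniform `w` anywhere).
* **`transportLeaf_assembled_mod_swin_of_schedule_canonical`** [bookkeeping] — leaf-04's ONE-SCHEDULE form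
  `transportLeaf_assembled_mod_swin_of_schedule W` (all sixteen geometric/radius/window binders discharged from ONE
  `W : WindowScheduleModWin r w`, radii = `W.sliceRadius`) with `Asz := aszRec T.gen s (s1Mod T.gen r α c Sg δf)`,
  `s1 := s1Mod T.gen r α c Sg δf`: the THREE remaining bookkeeping binders `hs1`/`hAsz_birth`/`hAsz_step` are GONE and NOTHING
  is added.  What is displayed is the wall and the dictionary ONLY: (w1) `hsl` on `bondBall d (W.ρw k′)` with slice window
  `W.wc k′`; F-2 `hFn`/`h𝒢` + the H2 dictionary `hQ`/`hSg`; (w2-act) `hB`/`hE` on `bondBall d (W.ρw (k+1))` / `W.wc (k+1)` /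
  `W.ϱc k`; (I4′) `hδf`/`hδfwk`/`hpairx`/`hrate`/`hdefwk`; (w4) `hdom : e³(1 + 4·(2σ k)/ϱc k) ≤ α k`; the cutoff-free source
  condition `hcm : ‖c b k‖ ≤ m`; F-8 `hlin`; `hinv`, `hmeas`, `hDμ`, `hz₁`, signs.
Conclusions: VERBATIM the field type of `BookingLeaves.htr` (`C = 4c_δ/r`, `ρ i = ψ·α i`).

HONEST FRAMING.  Rung (B)+1 bookkeeping on ONE finite four-torus of fixed physical size — NOT infinite volume, NOT a mass gap, NOT
OS on ℝ⁴, NOT the Clay problem, NOT summit progress.  NE1′ is NOT PRINTED and NOT PROVED; headline «L-T ⇐ F-1, F-2 (+ the H2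
dictionary `hQ`/`hSg`), F-3, F-6, F-7, F-8 on the assembled slice-window moduli face from ONE cutoff-free schedule, with no
bookkeeping functions displayed», never «NE1′ proved»; every wall binder of `t4/T4-EST-NE1p-P1.md` §4 stays DISPLAYED ((w1) `hsl`,
(w2-act) `hB`/`hE` — printed TYPE [Balaban1989LargeFieldII] (1.65) p. 375, (1.71)–(1.75) pp. 379–380, asserted for Bałaban's
densities NOWHERE —, (w4) `hdom`, (I4′) `hrate`/`hδf`/`hpairx`, the moduli condition `‖c b k‖ ≤ m`, attainment, invariance); the
K-freeness question sits ENTIRELY in those displayed binders (caveat k1); 0 binders are instantiated on Bałaban's densities; no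
`def`, no `def … : Prop`; [folklore] kernel glue, 0 sorry, 0 citations used as hypothesis-free facts.  Spine PROVED 0∕9 unchanged.
HONEST DEPENDENCY: continuum YM on T⁴ ⇐ BetaPertH ∧ nine spine estimates (0/9 proved); BetaPertH ⇐ (D1) ∧ (D4) ∧ CAP+tail;
G-an2-4 gates asym, D1 and NE2/3/4.
-/

noncomputable section

namespace Summit.QuantumFields.BalabanUV.T4Continuum.NE1p.DressedTransportAssembledModSliceWinData

open MeasureTheory Set Metric Filter Finset
open scoped BigOperators
open Literature.MathematicalPhysics.QuantumFieldTheory.Balaban1983to89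
open Literature.MathematicalPhysics.QuantumFieldTheory.Balaban1983to89.T4TermFormat
open Literature.MathematicalPhysics.QuantumFieldTheory.Balaban1983to89.T4TermFormat.Booking
open Literature.MathematicalPhysics.QuantumFieldTheory.Balaban1983to89.T4GatedBooking
open Literature.MathematicalPhysics.QuantumFieldTheory.Balaban1983to89.T4TrajectoryComparison
open Literature.MathematicalPhysics.QuantumFieldTheory.Balaban1983to89.T4TrajectoryModulus
open Summit.QuantumFields.BalabanUV.T4Continuum.T4TrajectoryDensityDressed
open Summit.QuantumFields.BalabanUV.T4Continuum.NE1p.DressedRoot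
open Summit.QuantumFields.BalabanUV.T4Continuum.NE1p.DressedTransportAssembled
open Summit.QuantumFields.BalabanUV.T4Continuum.NE1p.DressedTransportAssembledData
open Summit.QuantumFields.BalabanUV.T4Continuum.NE1p.DressedTransportAssembledMod
open Summit.QuantumFields.BalabanUV.T4Continuum.NE1p.DressedTransportAssembledModData
open Summit.QuantumFields.BalabanUV.T4Continuum.NE1p.DressedWindowScheduleWin
open Summit.QuantumFields.BalabanUV.T4Continuum.NE1p.DressedWindowScheduleModWin
open Summit.QuantumFields.BalabanUV.T4Continuum.NE1p.DressedTransportAssembledModSliceWin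
open T4BirthChartTransport (GaugeInvariant BirthSlice RelGauge)
open T4BlockTransport (Fld NDir latMove latN latMove_zero)
open T4TrajectoryDensity

variable {B : T4TermFormat.Booking} {T : Trajectory B}
variable {R : Type*} [NormedRing R] [NormedAlgebra ℂ R] [MeasurableSpace R] {d : ℕ}

/-! ## §1 END-F′-mod-swin over the canonical data [bookkeeping] -/

section FunctionLevel

/-- **END-F′-mod-swin OVER THE CANONICAL DATA — THE TRANSPORT LEAF `htr` OF `BookingLeaves` ON THE PER-STEP-SLICE-WINDOW MODULI
FACE WITH NO BOOKKEEPING FUNCTIONS DISPLAYED** [bookkeeping]: leaf-04's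
`DressedTransportAssembledModSliceWin.transportLeaf_assembled_mod_swin` (END-F′-mod-swin) with `rs := rsOf r ϱ`,
`Asz := aszRec T.gen s (s1Mod T.gen r α c Sg δf)`, `s1 := s1Mod T.gen r α c Sg δf`; its six bookkeeping binders `hs1`/`hAsz_birth`/
`hAsz_step`/`hrs_birth`/`hrs_step`/`hrs_dec` are the data lemmas of `DressedTransportAssembledModData` (`s1Mod_eq`, `aszRec_birth`,
`aszRec_succ`, `rsOf_birth`, `rsOf_succ`, `rsOf_dec`), so they DISAPPEAR together with the free functions `s1`/`rs`/`Asz`; the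
radius schedule enters through `hϱ_birth : ϱ f k″ k″ < r` and `hϱ_succ : ϱ f k″ (k+1) < ϱ f k″ k` only.  Displayed binders:
END-F-swin's wall items (F-1 `hsl` at the birth-step slice window `wk b k′ k′`; F-2 `hFn`/`h𝒢` and the H2 dictionary `hQ`/`hSg`;
F-3 `hB`/`hE` (slice window `wk b k′ (k+1)`); F-5 `hN1`/`hN2` (guard `latN p ≤ wk b k′ (k+1)`)/`hdiam`/`hθ`/`hθwk`/`hwk`/`hwk_anti`/
`hN1x`/`hN2cx` (guard `latN pd ≤ wk b k′ (k+1)`)/`hwkx`/`hmargin` (over `rsOf r ϱ`)/`hϱ_birth`/`hϱ_succ`; F-6 `hrate`/`hdefwk`/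
`hδf`/`hδfwk`/`hpairx` (guard `latN pd ≤ wk b k′ (k+1)`); F-7 `hdom`; F-8 `hlin`; F-9 `hα`/`hr`/`hcδ`/`hψ`/`hD`/`hϱ`/`hDμ`;
measurability `hmeas`; invariance `hinv`) and the ONE cutoff-free scalar condition `hcm : ‖c b k‖ ≤ m`.  NO `hP`, NO `hs`, NO
budget binder, NO radius floor, NO uniform slice window, NO bookkeeping equality.  Conclusion: EXACTLY the field `htr` of
`BookingLeaves` (`C = 4c_δ/r`, `ρ i = ψ·α i`).  Nothing of Bałaban's densities is asserted. [folklore] -/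
theorem transportLeaf_assembled_mod_swin_canonical {Fn : B.Birth → ℕ → ℕ → Fld d R → ℂ}
    {rel : B.Birth → ℕ → ℕ → Fld d R → Fld d R → Prop} {𝒦 : B.Birth → ℕ → ℕ → Set (Fld d R)}
    {ref : B.Birth → ℕ → Fld d R → Fld d R} {base : B.Birth → ℕ → Fld d R → ℝ}
    {𝒜 𝒬 : B.Birth → ℕ → Fld d R → Fld d R → ℂ} {q : B.Birth → ℕ → Fld d R → ℂ}
    {μ : B.Birth → ℕ → Measure (Fld d R)} {z₀ z₁ : B.Birth → ℕ → Fld d R} {D : B.Birth → ℕ → Set (Fld d R)}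
    {defect : B.Birth → ℕ → ℕ → ℝ} {cδ ψ w r m : ℝ} {s θ ϱ₁ : B.Birth → ℕ → ℝ} {α : ℕ → ℝ}
    {ϱ wk : B.Birth → ℕ → ℕ → ℝ} {S : ℕ → B.Birth → Finset B.Birth}
    {Sg : ℕ → B.Birth → Finset (B.Birth × ℕ)} {c : B.Birth → ℕ → ℂ} {δf : B.Birth → ℕ → B.Birth × ℕ → ℝ}
    (hα : ∀ i, 0 ≤ α i) (hr : 0 < r) (hcδ : 0 ≤ cδ) (hψ : 0 ≤ ψ)
    (hsl : ∀ (b : B.Birth) (k' : ℕ), B.birthScale b ≤ k' → k' ≤ B.K →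
      RanBelow (budgetGate T s m S (4 * cδ / r) (fun i => ψ * α i)) k' →
      BirthSlice (Fn b k' k') latMove latN (𝒦 b k' k') (wk b k' k') r (T.gen b k'))
    (hFn : ∀ (b : B.Birth) (k' k : ℕ), B.birthScale b ≤ k' → k' ≤ k → k + 1 ≤ B.K →
      RanBelow (budgetGate T s m S (4 * cδ / r) (fun i => ψ * α i)) (k + 1) →
      ∀ U, Fn b k' (k + 1) U =
        wOp (expWeight (base b k) (𝒜 b k + 𝒬 b k)) (μ b k) (z₀ b k) U (fun z => Fn b k' k (U + z)))
    (h𝒢 : ∀ (b : B.Birth) (k' k : ℕ), B.birthScale b ≤ k' → k' ≤ k → k + 1 ≤ B.K →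
      RanBelow (budgetGate T s m S (4 * cδ / r) (fun i => ψ * α i)) (k + 1) →
      ∀ U, (fun z => Fn b k' k (U + z)) ∈ BddClass ℂ (μ b k))
    (hD : ∀ b k, (D b k).Nonempty) (hϱ : ∀ b k' k, 0 < ϱ b k' k)
    (hB : ∀ (b : B.Birth) (k' k : ℕ), B.birthScale b ≤ k' → k' ≤ k → k + 1 ≤ B.K →
      RanBelow (budgetGate T s m S (4 * cδ / r) (fun i => ψ * α i)) (k + 1) →
      RealBaseAt (ref b k) (base b k) (𝒜 b k) (μ b k) (𝒦 b k' (k + 1)))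
    (hE : ∀ (b : B.Birth) (k' k : ℕ), B.birthScale b ≤ k' → k' ≤ k → k + 1 ≤ B.K →
      RanBelow (budgetGate T s m S (4 * cδ / r) (fun i => ψ * α i)) (k + 1) →
      ExponentSliceAt (ref b k) (𝒜 b k) (μ b k) latMove latN (𝒦 b k' (k + 1)) (wk b k' (k + 1)) (ϱ b k' k) (s b k))
    -- the Assembly's dictionary: the centred observable-attached exponent IS the fresh sum over the live generations
    (hQ : ∀ b k, (fun U z => 𝒬 b k U z - q b k U) =
      fun U z => c b k * ∑ p ∈ Sg k b, (Fn p.1 p.2 k (U + z) - Fn p.1 p.2 k (U + z₁ b k)))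
    (hSg : ∀ k b, ∀ p ∈ Sg k b, p.1 ∈ S k b ∧ B.birthScale p.1 ≤ p.2 ∧ p.2 ≤ k)
    -- the radius schedule: shrinking chart radii (F-5), below the birth radius from the start
    (hϱ_birth : ∀ (f : B.Birth) (k'' : ℕ), B.birthScale f ≤ k'' → ϱ f k'' k'' < r)
    (hϱ_succ : ∀ (f : B.Birth) (k'' k : ℕ), B.birthScale f ≤ k'' → k'' ≤ k → ϱ f k'' (k + 1) < ϱ f k'' k)
    (hmargin : ∀ (b : B.Birth) (k' k : ℕ), B.birthScale b ≤ k' → k' ≤ k →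
      ϱ b k' k < ϱ₁ b k ∧ 0 < ϱ₁ b k ∧ ∀ p ∈ Sg k b, ϱ₁ b k ≤ rsOf r ϱ p.1 p.2 k)
    -- the cutoff-free source-vs-budget condition
    (hcm : ∀ b k, ‖c b k‖ ≤ m)
    (hδf : ∀ b k, ∀ p ∈ Sg k b, 0 ≤ δf b k p ∧ δf b k p ≤ cδ * ψ ^ (k - p.2))
    (hδfwk : ∀ b k, ∀ p ∈ Sg k b, δf b k p ≤ wk p.1 p.2 k)
    -- per-step slice windows are non-increasing along a met step, across families
    (hwkx : ∀ (b : B.Birth) (k' k : ℕ), B.birthScale b ≤ k' → k' ≤ k → ∀ p ∈ Sg k b, wk b k' (k + 1) ≤ wk p.1 p.2 k)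
    (hDμ : ∀ b k, ∀ᵐ z ∂μ b k, z ∈ D b k)
    (hN1 : ∀ (b : B.Birth) (k' k : ℕ), B.birthScale b ≤ k' → k' ≤ k → k + 1 ≤ B.K →
      ∀ z ∈ D b k, ∀ U ∈ 𝒦 b k' (k + 1), U + z ∈ 𝒦 b k' k)
    (hN2 : ∀ (b : B.Birth) (k' k : ℕ), B.birthScale b ≤ k' → k' ≤ k → k + 1 ≤ B.K →
      ∀ U₀ ∈ 𝒦 b k' (k + 1), ∀ p : NDir d R, latN p ≤ wk b k' (k + 1) → ∀ z' ∈ D b k,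
        latMove U₀ p 1 + z' ∈ 𝒦 b k' k)
    (hN1x : ∀ (b : B.Birth) (k' k : ℕ), B.birthScale b ≤ k' → k' ≤ k →
      ∀ p ∈ Sg k b, ∀ z ∈ D b k, ∀ U ∈ 𝒦 b k' (k + 1), U + z ∈ 𝒦 p.1 p.2 k)
    -- (N2ᶜ) cross-family margin and the fresh pairs, guarded by the NEXT step's slice window (LF-2's cure)
    (hN2cx : ∀ (b : B.Birth) (k' k : ℕ), B.birthScale b ≤ k' → k' ≤ k →
      ∀ p ∈ Sg k b, ∀ U₀ ∈ 𝒦 b k' (k + 1), ∀ pd : NDir d R, 0 < latN pd → latN pd ≤ wk b k' (k + 1) →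
        ∀ t ∈ tube (ϱ₁ b k / latN pd), latMove U₀ pd t + z₁ b k ∈ 𝒦 p.1 p.2 k)
    (hpairx : ∀ (b : B.Birth) (k' k : ℕ), B.birthScale b ≤ k' → k' ≤ k →
      ∀ p ∈ Sg k b, ∀ U₀ ∈ 𝒦 b k' (k + 1), ∀ pd : NDir d R, 0 < latN pd → latN pd ≤ wk b k' (k + 1) →
        ∀ᵐ z ∂μ b k, ∀ t ∈ tube (ϱ₁ b k / latN pd),
          RelGauge (rel p.1 p.2 k) latMove latN (latMove U₀ pd t + z₁ b k) (latMove U₀ pd t + z) (δf b k p))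
    (hdiam : ∀ b k, ∀ z ∈ D b k, ∀ z' ∈ D b k, ∀ x ν, ‖z x ν - z' x ν‖ ≤ θ b k)
    (hθ : ∀ b k, 0 < θ b k ∧ θ b k ≤ w) (hθwk : ∀ b k' k, θ b k ≤ wk b k' k)
    (hwk : ∀ b k' k, wk b k' k ≤ w) (hwk_anti : ∀ b k' k, wk b k' (k + 1) ≤ wk b k' k)
    (hdom : ∀ (b : B.Birth) (k' k : ℕ), B.birthScale b ≤ k' → k' ≤ k → k + 1 ≤ B.K →
      Real.exp 3 * (1 + 4 * θ b k / ϱ b k' k) ≤ α k)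
    (hinv : ∀ b k' k, GaugeInvariant (rel b k' k) (Fn b k' k))
    (hmeas : ∀ (b f : B.Birth) (k'' k : ℕ) (U : Fld d R), AEStronglyMeasurable (fun z => Fn f k'' k (U + z)) (μ b k))
    (hdefwk : ∀ b k' k, defect b k' k ≤ wk b k' k)
    (hrate : ∀ (b : B.Birth) (k' k : ℕ), B.birthScale b ≤ k' → k' ≤ k → k ≤ B.K →
      defect b k' k ≤ cδ * ψ ^ (k - k'))
    (hlin : ∀ (b : B.Birth) (k' k : ℕ), B.birthScale b ≤ k' → k' ≤ k → k ≤ B.K →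
      RanBelow (budgetGate T s m S (4 * cδ / r) (fun i => ψ * α i)) k → ∀ ε > 0,
      ∃ U₀ ∈ 𝒦 b k' k, ∃ U₁ : Fld d R, RelGauge (rel b k' k) latMove latN U₀ U₁ (defect b k' k) ∧
        T.lin b k' k ≤ ‖Fn b k' k U₁ - Fn b k' k U₀‖ + ε) :
    T.TransportsFromVar (4 * cδ / r) (fun i => ψ * α i) (budgetGate T s m S (4 * cδ / r) (fun i => ψ * α i)) :=
  transportLeaf_assembled_mod_swin (rs := rsOf r ϱ) (Asz := aszRec T.gen s (s1Mod T.gen r α c Sg δf))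
    (s1 := s1Mod T.gen r α c Sg δf) hα hr hcδ hψ hsl hFn h𝒢 hD hϱ hB hE hQ hSg (s1Mod_eq T.gen r α c Sg δf)
    (aszRec_birth T.gen s (s1Mod T.gen r α c Sg δf)) (rsOf_birth r ϱ)
    (fun f _ _ _ hk => aszRec_succ T.gen s (s1Mod T.gen r α c Sg δf) f hk) (fun f _ _ _ hk => rsOf_succ r ϱ f hk)
    (rsOf_dec hϱ_birth hϱ_succ) hmargin hcm hδf hδfwk hwkx hDμ hN1 hN2 hN1x hN2cx hpairx hdiam hθ hθwk hwk hwk_anti hdom hinv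
    hmeas hdefwk hrate hlin

end FunctionLevel

/-! ## §2 The one-schedule form over the canonical data [bookkeeping] -/

section Scheduled

variable {r w : ℝ} (W : WindowScheduleModWin r w)

/-- **END-F′-mod-swin FROM ONE CUTOFF-FREE SCHEDULE, OVER THE CANONICAL DATA — THE ASSEMBLED SLICE-WINDOW TRANSPORT LEAF WITH
NOTHING BUT THE WALL AND THE DICTIONARY DISPLAYED** [bookkeeping]: leaf-04's
`DressedTransportAssembledModSliceWin.transportLeaf_assembled_mod_swin_of_schedule W` (all sixteen geometric/radius/window
binders of END-F′-mod-swin discharged from ONE `W : WindowScheduleModWin r w` — windows `bondBall d (W.ρw k)`, fluctuation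
supports `bondBall d (W.σ k)`, slice windows `W.wc k`, chart radii `W.ϱc k`, margins `W.ϱ₁ k`, slice radii `W.sliceRadius`)
with `Asz := aszRec T.gen s (s1Mod T.gen r α c Sg δf)` and `s1 := s1Mod T.gen r α c Sg δf`: the three remaining bookkeeping
binders `hs1`/`hAsz_birth`/`hAsz_step` are `s1Mod_eq`/`aszRec_birth`/`aszRec_succ`, so they DISAPPEAR together with the free
functions `s1`/`Asz`, and NOTHING is added.  Displayed binders = the wall and the dictionary ONLY: (w1) `hsl` (birth slice on
`bondBall d (W.ρw k′)`, slice window `W.wc k′`, radius `r`); F-2 `hFn`/`h𝒢` and the H2 dictionary `hQ`/`hSg`; (w2-act) `hB`/`hE`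
(on `bondBall d (W.ρw (k+1))`, slice window `W.wc (k+1)`, chart radius `W.ϱc k`); (I4′) `hδf`/`hδfwk`/`hpairx` (guard
`latN pd ≤ W.wc (k+1)`, tube `W.ϱ₁ k / latN pd`)/`hrate`/`hdefwk`; (w4) `hdom : e³·(1 + 4·(2·W.σ k)/W.ϱc k) ≤ α k`; the ONE
cutoff-free scalar condition `hcm : ‖c b k‖ ≤ m`; F-8 `hlin`; `hinv`, `hmeas`, `hDμ`, `hz₁`; signs `hα`/`hr`/`hcδ`/`hψ`.  NO
`hP`, NO `hs`, NO budget binder, NO radius floor, NO uniform slice window, NO bookkeeping function, NO bookkeeping equality.  With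
leaf-04's `WindowScheduleModWin.geometric` the schedule's birth window is the cutoff-free `ρ∞ + ((1+2q)σ₀+ϱ₀)/(1−q)` (row S1e):
on THIS face the typed window/radius/size bookkeeping of the assembled transport leaf forces no cutoff-dependent constant — the
K-freeness question sits entirely in the displayed estimate binders (caveat k1), which are asserted of Bałaban's densities
NOWHERE.  Conclusion: EXACTLY the field `htr` of `BookingLeaves` (`C = 4c_δ/r`, `ρ i = ψ·α i`). [folklore] -/
theorem transportLeaf_assembled_mod_swin_of_schedule_canonical {Fn : B.Birth → ℕ → ℕ → Fld d R → ℂ}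
    {rel : B.Birth → ℕ → ℕ → Fld d R → Fld d R → Prop}
    {ref : B.Birth → ℕ → Fld d R → Fld d R} {base : B.Birth → ℕ → Fld d R → ℝ}
    {𝒜 𝒬 : B.Birth → ℕ → Fld d R → Fld d R → ℂ} {q : B.Birth → ℕ → Fld d R → ℂ}
    {μ : B.Birth → ℕ → Measure (Fld d R)} {z₀ z₁ : B.Birth → ℕ → Fld d R}
    {defect : B.Birth → ℕ → ℕ → ℝ} {cδ ψ m : ℝ} {s : B.Birth → ℕ → ℝ} {α : ℕ → ℝ}
    {S : ℕ → B.Birth → Finset B.Birth} {Sg : ℕ → B.Birth → Finset (B.Birth × ℕ)} {c : B.Birth → ℕ → ℂ}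
    {δf : B.Birth → ℕ → B.Birth × ℕ → ℝ}
    (hα : ∀ i, 0 ≤ α i) (hr : 0 < r) (hcδ : 0 ≤ cδ) (hψ : 0 ≤ ψ)
    (hsl : ∀ (b : B.Birth) (k' : ℕ), B.birthScale b ≤ k' → k' ≤ B.K →
      RanBelow (budgetGate T s m S (4 * cδ / r) (fun i => ψ * α i)) k' →
      BirthSlice (Fn b k' k') latMove latN (bondBall d (W.ρw k') : Set (Fld d R)) (W.wc k') r (T.gen b k'))
    (hFn : ∀ (b : B.Birth) (k' k : ℕ), B.birthScale b ≤ k' → k' ≤ k → k + 1 ≤ B.K →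
      RanBelow (budgetGate T s m S (4 * cδ / r) (fun i => ψ * α i)) (k + 1) →
      ∀ U, Fn b k' (k + 1) U =
        wOp (expWeight (base b k) (𝒜 b k + 𝒬 b k)) (μ b k) (z₀ b k) U (fun z => Fn b k' k (U + z)))
    (h𝒢 : ∀ (b : B.Birth) (k' k : ℕ), B.birthScale b ≤ k' → k' ≤ k → k + 1 ≤ B.K →
      RanBelow (budgetGate T s m S (4 * cδ / r) (fun i => ψ * α i)) (k + 1) →
      ∀ U, (fun z => Fn b k' k (U + z)) ∈ BddClass ℂ (μ b k))
    (hB : ∀ (b : B.Birth) (k' k : ℕ), B.birthScale b ≤ k' → k' ≤ k → k + 1 ≤ B.K →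
      RanBelow (budgetGate T s m S (4 * cδ / r) (fun i => ψ * α i)) (k + 1) →
      RealBaseAt (ref b k) (base b k) (𝒜 b k) (μ b k) (bondBall d (W.ρw (k + 1)) : Set (Fld d R)))
    (hE : ∀ (b : B.Birth) (k' k : ℕ), B.birthScale b ≤ k' → k' ≤ k → k + 1 ≤ B.K →
      RanBelow (budgetGate T s m S (4 * cδ / r) (fun i => ψ * α i)) (k + 1) →
      ExponentSliceAt (ref b k) (𝒜 b k) (μ b k) latMove latN (bondBall d (W.ρw (k + 1)) : Set (Fld d R))
        (W.wc (k + 1)) (W.ϱc k) (s b k))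
    -- the Assembly's dictionary: the centred observable-attached exponent IS the fresh sum over the live generations
    (hQ : ∀ b k, (fun U z => 𝒬 b k U z - q b k U) =
      fun U z => c b k * ∑ p ∈ Sg k b, (Fn p.1 p.2 k (U + z) - Fn p.1 p.2 k (U + z₁ b k)))
    (hSg : ∀ k b, ∀ p ∈ Sg k b, p.1 ∈ S k b ∧ B.birthScale p.1 ≤ p.2 ∧ p.2 ≤ k)
    -- the cutoff-free source-vs-budget condition
    (hcm : ∀ b k, ‖c b k‖ ≤ m)
    (hδf : ∀ b k, ∀ p ∈ Sg k b, 0 ≤ δf b k p ∧ δf b k p ≤ cδ * ψ ^ (k - p.2))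
    (hδfwk : ∀ b k, ∀ p ∈ Sg k b, δf b k p ≤ W.wc k)
    (hDμ : ∀ b k, ∀ᵐ z ∂μ b k, z ∈ (bondBall d (W.σ k) : Set (Fld d R)))
    (hz₁ : ∀ b k, z₁ b k ∈ (bondBall d (W.σ k) : Set (Fld d R)))
    (hpairx : ∀ (b : B.Birth) (k' k : ℕ), B.birthScale b ≤ k' → k' ≤ k →
      ∀ p ∈ Sg k b, ∀ U₀ ∈ (bondBall d (W.ρw (k + 1)) : Set (Fld d R)), ∀ pd : NDir d R, 0 < latN pd →
        latN pd ≤ W.wc (k + 1) → ∀ᵐ z ∂μ b k, ∀ t ∈ tube (W.ϱ₁ k / latN pd),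
          RelGauge (rel p.1 p.2 k) latMove latN (latMove U₀ pd t + z₁ b k) (latMove U₀ pd t + z) (δf b k p))
    (hdom : ∀ k, k + 1 ≤ B.K → Real.exp 3 * (1 + 4 * (2 * W.σ k) / W.ϱc k) ≤ α k)
    (hinv : ∀ b k' k, GaugeInvariant (rel b k' k) (Fn b k' k))
    (hmeas : ∀ (b f : B.Birth) (k'' k : ℕ) (U : Fld d R), AEStronglyMeasurable (fun z => Fn f k'' k (U + z)) (μ b k))
    (hdefwk : ∀ (_b : B.Birth) (_k' k : ℕ), defect _b _k' k ≤ W.wc k)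
    (hrate : ∀ (b : B.Birth) (k' k : ℕ), B.birthScale b ≤ k' → k' ≤ k → k ≤ B.K →
      defect b k' k ≤ cδ * ψ ^ (k - k'))
    (hlin : ∀ (b : B.Birth) (k' k : ℕ), B.birthScale b ≤ k' → k' ≤ k → k ≤ B.K →
      RanBelow (budgetGate T s m S (4 * cδ / r) (fun i => ψ * α i)) k → ∀ ε > 0,
      ∃ U₀ ∈ (bondBall d (W.ρw k) : Set (Fld d R)), ∃ U₁ : Fld d R,
        RelGauge (rel b k' k) latMove latN U₀ U₁ (defect b k' k) ∧
        T.lin b k' k ≤ ‖Fn b k' k U₁ - Fn b k' k U₀‖ + ε) :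
    T.TransportsFromVar (4 * cδ / r) (fun i => ψ * α i) (budgetGate T s m S (4 * cδ / r) (fun i => ψ * α i)) :=
  transportLeaf_assembled_mod_swin_of_schedule (W := W) (Asz := aszRec T.gen s (s1Mod T.gen r α c Sg δf))
    (s1 := s1Mod T.gen r α c Sg δf) hα hr hcδ hψ hsl hFn h𝒢 hB hE hQ hSg (s1Mod_eq T.gen r α c Sg δf)
    (aszRec_birth T.gen s (s1Mod T.gen r α c Sg δf))
    (fun f _ _ _ hk => aszRec_succ T.gen s (s1Mod T.gen r α c Sg δf) f hk)
    hcm hδf hδfwk hDμ hz₁ hpairx hdom hinv hmeas hdefwk hrate hlin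

end Scheduled

end Summit.QuantumFields.BalabanUV.T4Continuum.NE1p.DressedTransportAssembledModSliceWinData

end
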